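/-
Copyright (c) 2026 the pub-hodgecm-mathlib formalisation cell (harness21).  Prover seat hodgecm-mathlib-K2E5-p16 (g6), Track B «K2-LIT»,
#184♮ = hLiu418 = `stmt-HodgeConjecture-24832`; organ S2-J (LEAD F0P6-plan (g14) BATCH #17 (2)), file J0-b `K2LiuArchTensorSignFrames`:
`K_w ⊗ 1 ⊆ K_𝕎` BLOCKWISE — a matrix `h` that is block-diagonal in the sign frame of `x` gives `h ⊗ 1` block-diagonal in the sign frame of
the Kronecker sign vector `z = x ⊗ y`, with `𝕎⁺`-block `(h⁺ ⊗ 1_{V′⁺}) ⊕ (h⁻ ⊗ 1_{V′⁻})`, `𝕎⁻`-block `(h⁺ ⊗ 1_{V′⁻}) ⊕ (h⁻ ⊗ 1_{V′⁺})`, and the two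
determinants `det(h⁺)^{p′}·det(h⁻)^{q′}`, `det(h⁺)^{q′}·det(h⁻)^{p′}`.  THEOREMS ONLY (no `def`, no `instance`, no notation, no `sorry`).
-/
import Summits.HodgeConjecture.HodgeConjecture.Theorems.K2LiuArchTensorSignFramesDefs   -- J0-a (this seat): `posIdxTensorEquiv`, `negIdxTensorEquiv`
import Mathlib.LinearAlgebra.Matrix.Kronecker
import HarnessLib

/-!
# Crux `HLiu418`, organ S2-J, file J0-b: `K_w ⊗ 1 ⊆ K_𝕎` blockwise, with the two determinant exponents

Cell `hodgecm-mathlib`, crux item hLiu418 = `stmt-HodgeConjecture-24832` (helper lane `--supports`, count-neutral).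

For `h : Matrix (Fin N) (Fin N) ℂ` BLOCK-DIAGONAL in the sign frame of `x` (`h a a′ = 0` whenever `x_a`, `x_{a′}` have different signs —
i.e. `h ∈ K_w = U(𝔻_w⁺) × U(𝔻_w⁻)` in the sign-sorted frame) and the Kronecker element `reindex e e (h ⊗ₖ 1)` on `𝕎 = 𝔻 ⊗ V′`:
* `submatrix_posIdx_kronecker_one` ∕ `submatrix_negIdx_kronecker_one`: its `𝕎⁺`- and `𝕎⁻`-principal blocks are, along ★ J0-a's
  `posIdxTensorEquiv` ∕ `negIdxTensorEquiv`, `fromBlocks (h⁺ ⊗ₖ 1) 0 0 (h⁻ ⊗ₖ 1)` with `h^± = h|_{PosIdx x} ∕ h|_{NegIdx x}` and identity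
  sizes `(V′⁺, V′⁻)` resp. `(V′⁻, V′⁺)`; the off-diagonal blocks vanish (`kronecker_one_apply_of_sign_ne`);
* `det_submatrix_posIdx_kronecker_one` ∕ `det_submatrix_negIdx_kronecker_one`:
  **`det(𝕎⁺-block) = det(h⁺)^{|V′⁺|} · det(h⁻)^{|V′⁻|}`**, **`det(𝕎⁻-block) = det(h⁺)^{|V′⁻|} · det(h⁻)^{|V′⁺|}`** (Mathlib `det_kronecker`).
These are the exponents `(−q′, −p′)` of ★ `weilRepPair_κ_hermitePi_zero` ∕ ★ J1 `weilHomV_unit_kV_hermitePi_zero` read on `K_w ⊗ 1`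
(K2Liu-p05 (g5) S2-J census: `det B = ∏_v det(k₁,v)^{q′_v} det(k₂,v)^{p′_v}`); the `UForm.kV (A, B)` dictionary is the instantiation (J0-c).
References: [KonnoKonno2007, §3.1, Lemma 5.2]; [Kudla1994, §2]; [HarrisKudlaSweet1996, §1].
HONEST LABEL: HC_CM is proved only modulo the 7 printed citations (2 remaining named inputs: hLiu418 = stmt-HodgeConjecture-24832,
h413 = stmt-HodgeConjecture-24833) until rung 0 closes; count-neutral helper, closes no socket.
-/

set_option autoImplicit false
set_option linter.dupNamespace false

noncomputable section

open Matrix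
open scoped Kronecker

namespace Summit.HodgeConjecture.HodgeConjecture.Cruxes.HLiu418.K2LiuArchTensorSignFrames

open Literature.NumberTheory.Weil1964 (PosIdx NegIdx)

variable {N M n : ℕ}

/-- the entries of `reindex e e (h ⊗ₖ 1)`: `h_{a a′} · δ_{b b′}` at `(e(a,b), e(a′,b′))`. [folklore] -/
theorem reindex_kronecker_one_apply (e : Fin N × Fin M ≃ Fin n) (h : Matrix (Fin N) (Fin N) ℂ) (k k' : Fin n) :
    Matrix.reindex e e (h ⊗ₖ (1 : Matrix (Fin M) (Fin M) ℂ)) k k' =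
      h (e.symm k).1 (e.symm k').1 * (1 : Matrix (Fin M) (Fin M) ℂ) (e.symm k).2 (e.symm k').2 := by
  rw [Matrix.reindex_apply, Matrix.submatrix_apply, Matrix.kroneckerMap_apply]

/-- **off-diagonal vanishing**: if `h` is block-diagonal in the sign frame of `x`, the `(k, k′)` entry of `h ⊗ 1` vanishes whenever the
first tensor indices of `k`, `k′` have different `x`-signs. [folklore] -/
theorem kronecker_one_apply_of_sign_ne {x : Fin N → ℝ} (e : Fin N × Fin M ≃ Fin n) (h : Matrix (Fin N) (Fin N) ℂ)
    (hh : ∀ a a', (0 < x a ↔ ¬0 < x a') → h a a' = 0) (k k' : Fin n) (hk : 0 < x (e.symm k).1 ↔ ¬0 < x (e.symm k').1) :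
    Matrix.reindex e e (h ⊗ₖ (1 : Matrix (Fin M) (Fin M) ℂ)) k k' = 0 := by
  rw [reindex_kronecker_one_apply, hh _ _ hk, zero_mul]

/-- identity matrices on subtypes agree with the ambient identity. [folklore] -/
theorem one_apply_subtype {p : Fin M → Prop} (b b' : {j : Fin M // p j}) :
    (1 : Matrix {j : Fin M // p j} {j : Fin M // p j} ℂ) b b' = (1 : Matrix (Fin M) (Fin M) ℂ) b.1 b'.1 := by
  simp only [Matrix.one_apply, Subtype.ext_iff]

/-- **THE `𝕎⁺`-BLOCK OF `h ⊗ 1`**: along `posIdxTensorEquiv`, the principal `PosIdx z`-block of `reindex e e (h ⊗ₖ 1)` is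
`fromBlocks (h⁺ ⊗ₖ 1_{V′⁺}) 0 0 (h⁻ ⊗ₖ 1_{V′⁻})`, `h^± = h` restricted to `PosIdx x` ∕ `NegIdx x`. [cite: KonnoKonno2007, §3.1] -/
theorem submatrix_posIdx_kronecker_one (x : Fin N → ℝ) (y : Fin M → ℝ) (e : Fin N × Fin M ≃ Fin n) (hx : ∀ i, x i ≠ 0)
    (hy : ∀ j, y j ≠ 0) (h : Matrix (Fin N) (Fin N) ℂ) (hh : ∀ a a', (0 < x a ↔ ¬0 < x a') → h a a' = 0) :
    (Matrix.reindex e e (h ⊗ₖ (1 : Matrix (Fin M) (Fin M) ℂ))).submatrix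
        (Subtype.val : PosIdx (fun k => x (e.symm k).1 * y (e.symm k).2) → Fin n) Subtype.val =
      Matrix.reindex (posIdxTensorEquiv x y e hx hy).symm (posIdxTensorEquiv x y e hx hy).symm
        (fromBlocks (h.submatrix (Subtype.val : PosIdx x → Fin N) Subtype.val ⊗ₖ (1 : Matrix (PosIdx y) (PosIdx y) ℂ)) 0 0
          (h.submatrix (Subtype.val : NegIdx x → Fin N) Subtype.val ⊗ₖ (1 : Matrix (NegIdx y) (NegIdx y) ℂ))) := by
  ext k k'
  simp only [Matrix.reindex_apply, Matrix.submatrix_apply, Equiv.symm_symm, Matrix.kroneckerMap_apply]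
  by_cases hk : 0 < x (e.symm k.1).1 <;> by_cases hk' : 0 < x (e.symm k'.1).1
  · rw [posIdxTensorEquiv_apply_of_pos x y e hx hy k hk, posIdxTensorEquiv_apply_of_pos x y e hx hy k' hk', fromBlocks_apply₁₁,
      Matrix.kroneckerMap_apply, Matrix.submatrix_apply, one_apply_subtype]
  · rw [posIdxTensorEquiv_apply_of_pos x y e hx hy k hk, posIdxTensorEquiv_apply_of_not_pos x y e hx hy k' hk', fromBlocks_apply₁₂,
      Matrix.zero_apply, hh _ _ (iff_of_true hk hk'), zero_mul]
  · rw [posIdxTensorEquiv_apply_of_not_pos x y e hx hy k hk, posIdxTensorEquiv_apply_of_pos x y e hx hy k' hk', fromBlocks_apply₂₁,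
      Matrix.zero_apply, hh _ _ (iff_of_false hk (not_not.2 hk')), zero_mul]
  · rw [posIdxTensorEquiv_apply_of_not_pos x y e hx hy k hk, posIdxTensorEquiv_apply_of_not_pos x y e hx hy k' hk', fromBlocks_apply₂₂,
      Matrix.kroneckerMap_apply, Matrix.submatrix_apply, one_apply_subtype]

/-- the non-positive branch equations of `negIdxTensorEquiv` (unfolding). [folklore] -/
theorem negIdxTensorEquiv_apply_of_pos (x : Fin N → ℝ) (y : Fin M → ℝ) (e : Fin N × Fin M ≃ Fin n) (hx : ∀ i, x i ≠ 0)
    (hy : ∀ j, y j ≠ 0) (k : NegIdx (fun k => x (e.symm k).1 * y (e.symm k).2)) (h : 0 < x (e.symm k.1).1) :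
    negIdxTensorEquiv x y e hx hy k = Sum.inl (⟨(e.symm k.1).1, h⟩, ⟨(e.symm k.1).2, not_pos_right_of_not_mul_pos k.2 h⟩) :=
  dif_pos h

/-- the non-positive branch equations of `negIdxTensorEquiv` (unfolding). [folklore] -/
theorem negIdxTensorEquiv_apply_of_not_pos (x : Fin N → ℝ) (y : Fin M → ℝ) (e : Fin N × Fin M ≃ Fin n) (hx : ∀ i, x i ≠ 0)
    (hy : ∀ j, y j ≠ 0) (k : NegIdx (fun k => x (e.symm k).1 * y (e.symm k).2)) (h : ¬0 < x (e.symm k.1).1) :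
    negIdxTensorEquiv x y e hx hy k = Sum.inr (⟨(e.symm k.1).1, h⟩, ⟨(e.symm k.1).2, pos_right_of_not_mul_pos k.2 h (hx _) (hy _)⟩) :=
  dif_neg h

/-- **THE `𝕎⁻`-BLOCK OF `h ⊗ 1`**: along `negIdxTensorEquiv`, the principal `NegIdx z`-block of `reindex e e (h ⊗ₖ 1)` is
`fromBlocks (h⁺ ⊗ₖ 1_{V′⁻}) 0 0 (h⁻ ⊗ₖ 1_{V′⁺})`. [cite: KonnoKonno2007, §3.1] -/
theorem submatrix_negIdx_kronecker_one (x : Fin N → ℝ) (y : Fin M → ℝ) (e : Fin N × Fin M ≃ Fin n) (hx : ∀ i, x i ≠ 0)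
    (hy : ∀ j, y j ≠ 0) (h : Matrix (Fin N) (Fin N) ℂ) (hh : ∀ a a', (0 < x a ↔ ¬0 < x a') → h a a' = 0) :
    (Matrix.reindex e e (h ⊗ₖ (1 : Matrix (Fin M) (Fin M) ℂ))).submatrix
        (Subtype.val : NegIdx (fun k => x (e.symm k).1 * y (e.symm k).2) → Fin n) Subtype.val =
      Matrix.reindex (negIdxTensorEquiv x y e hx hy).symm (negIdxTensorEquiv x y e hx hy).symm
        (fromBlocks (h.submatrix (Subtype.val : PosIdx x → Fin N) Subtype.val ⊗ₖ (1 : Matrix (NegIdx y) (NegIdx y) ℂ)) 0 0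
          (h.submatrix (Subtype.val : NegIdx x → Fin N) Subtype.val ⊗ₖ (1 : Matrix (PosIdx y) (PosIdx y) ℂ))) := by
  ext k k'
  simp only [Matrix.reindex_apply, Matrix.submatrix_apply, Equiv.symm_symm, Matrix.kroneckerMap_apply]
  by_cases hk : 0 < x (e.symm k.1).1 <;> by_cases hk' : 0 < x (e.symm k'.1).1
  · rw [negIdxTensorEquiv_apply_of_pos x y e hx hy k hk, negIdxTensorEquiv_apply_of_pos x y e hx hy k' hk', fromBlocks_apply₁₁,
      Matrix.kroneckerMap_apply, Matrix.submatrix_apply, one_apply_subtype]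
  · rw [negIdxTensorEquiv_apply_of_pos x y e hx hy k hk, negIdxTensorEquiv_apply_of_not_pos x y e hx hy k' hk', fromBlocks_apply₁₂,
      Matrix.zero_apply, hh _ _ (iff_of_true hk hk'), zero_mul]
  · rw [negIdxTensorEquiv_apply_of_not_pos x y e hx hy k hk, negIdxTensorEquiv_apply_of_pos x y e hx hy k' hk', fromBlocks_apply₂₁,
      Matrix.zero_apply, hh _ _ (iff_of_false hk (not_not.2 hk')), zero_mul]
  · rw [negIdxTensorEquiv_apply_of_not_pos x y e hx hy k hk, negIdxTensorEquiv_apply_of_not_pos x y e hx hy k' hk', fromBlocks_apply₂₂,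
      Matrix.kroneckerMap_apply, Matrix.submatrix_apply, one_apply_subtype]

/-- **`det(𝕎⁺-block) = det(h⁺)^{|V′⁺|} · det(h⁻)^{|V′⁻|}`.** [cite: KonnoKonno2007, Lemma 5.2] -/
theorem det_submatrix_posIdx_kronecker_one (x : Fin N → ℝ) (y : Fin M → ℝ) (e : Fin N × Fin M ≃ Fin n) (hx : ∀ i, x i ≠ 0)
    (hy : ∀ j, y j ≠ 0) (h : Matrix (Fin N) (Fin N) ℂ) (hh : ∀ a a', (0 < x a ↔ ¬0 < x a') → h a a' = 0) :
    ((Matrix.reindex e e (h ⊗ₖ (1 : Matrix (Fin M) (Fin M) ℂ))).submatrix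
        (Subtype.val : PosIdx (fun k => x (e.symm k).1 * y (e.symm k).2) → Fin n) Subtype.val).det =
      (h.submatrix (Subtype.val : PosIdx x → Fin N) Subtype.val).det ^ Fintype.card (PosIdx y) *
        (h.submatrix (Subtype.val : NegIdx x → Fin N) Subtype.val).det ^ Fintype.card (NegIdx y) := by
  rw [submatrix_posIdx_kronecker_one x y e hx hy h hh, Matrix.det_reindex_self, Matrix.det_fromBlocks_zero₂₁, Matrix.det_kronecker,
    Matrix.det_kronecker, Matrix.det_one, Matrix.det_one, one_pow, one_pow, mul_one, mul_one]

/-- **`det(𝕎⁻-block) = det(h⁺)^{|V′⁻|} · det(h⁻)^{|V′⁺|}`.** [cite: KonnoKonno2007, Lemma 5.2] -/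
theorem det_submatrix_negIdx_kronecker_one (x : Fin N → ℝ) (y : Fin M → ℝ) (e : Fin N × Fin M ≃ Fin n) (hx : ∀ i, x i ≠ 0)
    (hy : ∀ j, y j ≠ 0) (h : Matrix (Fin N) (Fin N) ℂ) (hh : ∀ a a', (0 < x a ↔ ¬0 < x a') → h a a' = 0) :
    ((Matrix.reindex e e (h ⊗ₖ (1 : Matrix (Fin M) (Fin M) ℂ))).submatrix
        (Subtype.val : NegIdx (fun k => x (e.symm k).1 * y (e.symm k).2) → Fin n) Subtype.val).det =
      (h.submatrix (Subtype.val : PosIdx x → Fin N) Subtype.val).det ^ Fintype.card (NegIdx y) *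
        (h.submatrix (Subtype.val : NegIdx x → Fin N) Subtype.val).det ^ Fintype.card (PosIdx y) := by
  rw [submatrix_negIdx_kronecker_one x y e hx hy h hh, Matrix.det_reindex_self, Matrix.det_fromBlocks_zero₂₁, Matrix.det_kronecker,
    Matrix.det_kronecker, Matrix.det_one, Matrix.det_one, one_pow, one_pow, mul_one, mul_one]

/-- **the off-diagonal blocks of `h ⊗ 1` in the sign frame of `z` vanish** (so `h ⊗ 1 ∈ K_𝕎` blockwise). [cite: KonnoKonno2007, §3.1] -/
theorem submatrix_posIdx_negIdx_kronecker_one (x : Fin N → ℝ) (y : Fin M → ℝ) (e : Fin N × Fin M ≃ Fin n) (hx : ∀ i, x i ≠ 0)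
    (hy : ∀ j, y j ≠ 0) (h : Matrix (Fin N) (Fin N) ℂ) (hh : ∀ a a', (0 < x a ↔ ¬0 < x a') → h a a' = 0) :
    (Matrix.reindex e e (h ⊗ₖ (1 : Matrix (Fin M) (Fin M) ℂ))).submatrix
        (Subtype.val : PosIdx (fun k => x (e.symm k).1 * y (e.symm k).2) → Fin n)
        (Subtype.val : NegIdx (fun k => x (e.symm k).1 * y (e.symm k).2) → Fin n) = 0 ∧
      (Matrix.reindex e e (h ⊗ₖ (1 : Matrix (Fin M) (Fin M) ℂ))).submatrix
        (Subtype.val : NegIdx (fun k => x (e.symm k).1 * y (e.symm k).2) → Fin n)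
        (Subtype.val : PosIdx (fun k => x (e.symm k).1 * y (e.symm k).2) → Fin n) = 0 := by
  constructor
  · ext k k'
    rw [Matrix.submatrix_apply, Matrix.zero_apply, reindex_kronecker_one_apply]
    by_cases hk : 0 < x (e.symm k.1).1
    · by_cases hk' : 0 < x (e.symm k'.1).1
      · -- then `0 < y_b` and `¬0 < y_{b′}`: the identity factor vanishes
        have hb : 0 < y (e.symm k.1).2 := pos_right_of_mul_pos k.2 hk
        have hb' : ¬0 < y (e.symm k'.1).2 := not_pos_right_of_not_mul_pos k'.2 hk'
        rw [Matrix.one_apply_ne (fun hbb => hb' (lt_of_lt_of_eq hb (congrArg y hbb))), mul_zero]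
      · rw [hh _ _ (iff_of_true hk hk'), zero_mul]
    · by_cases hk' : 0 < x (e.symm k'.1).1
      · rw [hh _ _ (iff_of_false hk (not_not.2 hk')), zero_mul]
      · have hb : ¬0 < y (e.symm k.1).2 := not_pos_right_of_mul_pos k.2 hk
        have hb' : 0 < y (e.symm k'.1).2 := pos_right_of_not_mul_pos k'.2 hk' (hx _) (hy _)
        rw [Matrix.one_apply_ne (fun hbb => hb (lt_of_lt_of_eq hb' (congrArg y hbb).symm)), mul_zero]
  · ext k k'
    rw [Matrix.submatrix_apply, Matrix.zero_apply, reindex_kronecker_one_apply]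
    by_cases hk : 0 < x (e.symm k.1).1
    · by_cases hk' : 0 < x (e.symm k'.1).1
      · have hb : ¬0 < y (e.symm k.1).2 := not_pos_right_of_not_mul_pos k.2 hk
        have hb' : 0 < y (e.symm k'.1).2 := pos_right_of_mul_pos k'.2 hk'
        rw [Matrix.one_apply_ne (fun hbb => hb (lt_of_lt_of_eq hb' (congrArg y hbb).symm)), mul_zero]
      · rw [hh _ _ (iff_of_true hk hk'), zero_mul]
    · by_cases hk' : 0 < x (e.symm k'.1).1
      · rw [hh _ _ (iff_of_false hk (not_not.2 hk')), zero_mul]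
      · have hb : 0 < y (e.symm k.1).2 := pos_right_of_not_mul_pos k.2 hk (hx _) (hy _)
        have hb' : ¬0 < y (e.symm k'.1).2 := not_pos_right_of_mul_pos k'.2 hk'
        rw [Matrix.one_apply_ne (fun hbb => hb' (lt_of_lt_of_eq hb (congrArg y hbb))), mul_zero]

/-! ## Adapter: the same facts keyed on an ARBITRARY sign vector `z` with `z_k = x_{(e⁻¹k)₁} · y_{(e⁻¹k)₂}` pointwise
(so that `PosIdx (signVec(𝕎) v)` ∕ `NegIdx (signVec(𝕎) v)` are used as they stand — no dependent rewriting) -/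

/-- **SIGN SEPARATION OF `h ⊗ 1`** (the hypothesis `hsep` of ★ `exists_archUFormPi_eq_kV_of_sign_separated` for the tensor element): if `h` is
block-diagonal in the sign frame of `x` and `z` is pointwise the Kronecker sign vector, then for `0 < z_k`, `¬0 < z_{k′}` both entries
`(h ⊗ 1)_{k k′}` and `(h ⊗ 1)_{k′ k}` vanish. [cite: KonnoKonno2007, §3.1] -/
theorem kronecker_one_sign_separated (x : Fin N → ℝ) (y : Fin M → ℝ) (e : Fin N × Fin M ≃ Fin n) (hx : ∀ i, x i ≠ 0) (hy : ∀ j, y j ≠ 0)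
    (z : Fin n → ℝ) (hz : ∀ k, z k = x (e.symm k).1 * y (e.symm k).2) (h : Matrix (Fin N) (Fin N) ℂ)
    (hh : ∀ a a', (0 < x a ↔ ¬0 < x a') → h a a' = 0) (k k' : Fin n) (hk : 0 < z k) (hk' : ¬0 < z k') :
    Matrix.reindex e e (h ⊗ₖ (1 : Matrix (Fin M) (Fin M) ℂ)) k k' = 0 ∧ Matrix.reindex e e (h ⊗ₖ (1 : Matrix (Fin M) (Fin M) ℂ)) k' k = 0 := by
  rw [hz] at hk hk'
  rw [reindex_kronecker_one_apply, reindex_kronecker_one_apply]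
  by_cases ha : 0 < x (e.symm k).1 <;> by_cases ha' : 0 < x (e.symm k').1
  · have hb : 0 < y (e.symm k).2 := pos_right_of_mul_pos hk ha
    have hb' : ¬0 < y (e.symm k').2 := not_pos_right_of_not_mul_pos hk' ha'
    have hne : (e.symm k).2 ≠ (e.symm k').2 := fun hbb => hb' (lt_of_lt_of_eq hb (congrArg y hbb))
    rw [Matrix.one_apply_ne hne, Matrix.one_apply_ne (Ne.symm hne), mul_zero, mul_zero]
    exact ⟨rfl, rfl⟩
  · rw [hh _ _ (iff_of_true ha ha'), hh _ _ (iff_of_false ha' (not_not.2 ha)), zero_mul, zero_mul]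
    exact ⟨rfl, rfl⟩
  · rw [hh _ _ (iff_of_false ha (not_not.2 ha')), hh _ _ (iff_of_true ha' ha), zero_mul, zero_mul]
    exact ⟨rfl, rfl⟩
  · have hb : ¬0 < y (e.symm k).2 := not_pos_right_of_mul_pos hk ha
    have hb' : 0 < y (e.symm k').2 := pos_right_of_not_mul_pos hk' ha' (hx _) (hy _)
    have hne : (e.symm k).2 ≠ (e.symm k').2 := fun hbb => hb (lt_of_lt_of_eq hb' (congrArg y hbb).symm)
    rw [Matrix.one_apply_ne hne, Matrix.one_apply_ne (Ne.symm hne), mul_zero, mul_zero]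
    exact ⟨rfl, rfl⟩

/-- **`det(𝕎⁺-block)`** keyed on an arbitrary `z` (pointwise the Kronecker sign vector). [cite: KonnoKonno2007, Lemma 5.2] -/
theorem det_submatrix_posIdx_kronecker_one_of_eq (x : Fin N → ℝ) (y : Fin M → ℝ) (e : Fin N × Fin M ≃ Fin n) (hx : ∀ i, x i ≠ 0)
    (hy : ∀ j, y j ≠ 0) (z : Fin n → ℝ) (hz : ∀ k, z k = x (e.symm k).1 * y (e.symm k).2) (h : Matrix (Fin N) (Fin N) ℂ)
    (hh : ∀ a a', (0 < x a ↔ ¬0 < x a') → h a a' = 0) :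
    ((Matrix.reindex e e (h ⊗ₖ (1 : Matrix (Fin M) (Fin M) ℂ))).submatrix (Subtype.val : PosIdx z → Fin n) Subtype.val).det =
      (h.submatrix (Subtype.val : PosIdx x → Fin N) Subtype.val).det ^ Fintype.card (PosIdx y) *
        (h.submatrix (Subtype.val : NegIdx x → Fin N) Subtype.val).det ^ Fintype.card (NegIdx y) := by
  let ε : PosIdx z ≃ PosIdx (fun k => x (e.symm k).1 * y (e.symm k).2) := Equiv.subtypeEquivRight fun k => by rw [hz k]
  have hε : (Matrix.reindex e e (h ⊗ₖ (1 : Matrix (Fin M) (Fin M) ℂ))).submatrix (Subtype.val : PosIdx z → Fin n) Subtype.val =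
      ((Matrix.reindex e e (h ⊗ₖ (1 : Matrix (Fin M) (Fin M) ℂ))).submatrix
        (Subtype.val : PosIdx (fun k => x (e.symm k).1 * y (e.symm k).2) → Fin n) Subtype.val).submatrix ε ε := by
    ext i j; rfl
  rw [hε, Matrix.det_submatrix_equiv_self, det_submatrix_posIdx_kronecker_one x y e hx hy h hh]

/-- **`det(𝕎⁻-block) = det(h⁺)^{|V′⁻|} · det(h⁻)^{|V′⁺|}`** keyed on an arbitrary `z` — the `det k.2` of
★ `det_of_archUFormPi_eq_kV_of_sign_separated` for `(k ⊗ 1)_w`. [cite: KonnoKonno2007, Lemma 5.2] -/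
theorem det_submatrix_negIdx_kronecker_one_of_eq (x : Fin N → ℝ) (y : Fin M → ℝ) (e : Fin N × Fin M ≃ Fin n) (hx : ∀ i, x i ≠ 0)
    (hy : ∀ j, y j ≠ 0) (z : Fin n → ℝ) (hz : ∀ k, z k = x (e.symm k).1 * y (e.symm k).2) (h : Matrix (Fin N) (Fin N) ℂ)
    (hh : ∀ a a', (0 < x a ↔ ¬0 < x a') → h a a' = 0) :
    ((Matrix.reindex e e (h ⊗ₖ (1 : Matrix (Fin M) (Fin M) ℂ))).submatrix (Subtype.val : NegIdx z → Fin n) Subtype.val).det =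
      (h.submatrix (Subtype.val : PosIdx x → Fin N) Subtype.val).det ^ Fintype.card (NegIdx y) *
        (h.submatrix (Subtype.val : NegIdx x → Fin N) Subtype.val).det ^ Fintype.card (PosIdx y) := by
  let ε : NegIdx z ≃ NegIdx (fun k => x (e.symm k).1 * y (e.symm k).2) := Equiv.subtypeEquivRight fun k => by rw [hz k]
  have hε : (Matrix.reindex e e (h ⊗ₖ (1 : Matrix (Fin M) (Fin M) ℂ))).submatrix (Subtype.val : NegIdx z → Fin n) Subtype.val =
      ((Matrix.reindex e e (h ⊗ₖ (1 : Matrix (Fin M) (Fin M) ℂ))).submatrix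
        (Subtype.val : NegIdx (fun k => x (e.symm k).1 * y (e.symm k).2) → Fin n) Subtype.val).submatrix ε ε := by
    ext i j; rfl
  rw [hε, Matrix.det_submatrix_equiv_self, det_submatrix_negIdx_kronecker_one x y e hx hy h hh]

/-- the signature counts keyed on an arbitrary `z`. [cite: KonnoKonno2007, §3.1] -/
theorem card_posIdx_negIdx_of_eq (x : Fin N → ℝ) (y : Fin M → ℝ) (e : Fin N × Fin M ≃ Fin n) (hx : ∀ i, x i ≠ 0) (hy : ∀ j, y j ≠ 0)
    (z : Fin n → ℝ) (hz : ∀ k, z k = x (e.symm k).1 * y (e.symm k).2) :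
    Fintype.card (PosIdx z) = Fintype.card (PosIdx x) * Fintype.card (PosIdx y) + Fintype.card (NegIdx x) * Fintype.card (NegIdx y) ∧
      Fintype.card (NegIdx z) = Fintype.card (PosIdx x) * Fintype.card (NegIdx y) + Fintype.card (NegIdx x) * Fintype.card (PosIdx y) := by
  have hP : Fintype.card (PosIdx z) = Fintype.card (PosIdx (fun k => x (e.symm k).1 * y (e.symm k).2)) :=
    Fintype.card_congr (Equiv.subtypeEquivRight fun k => by rw [hz k])
  have hN : Fintype.card (NegIdx z) = Fintype.card (NegIdx (fun k => x (e.symm k).1 * y (e.symm k).2)) :=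
    Fintype.card_congr (Equiv.subtypeEquivRight fun k => by rw [hz k])
  rw [hP, hN, card_posIdx_tensor x y e hx hy, card_negIdx_tensor x y e hx hy]
  exact ⟨rfl, rfl⟩

end Summit.HodgeConjecture.HodgeConjecture.Cruxes.HLiu418.K2LiuArchTensorSignFrames

end
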